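import Summits.BirchSwinnertonDyer.BirchSwinnertonDyer.Theorems.ThetaPartnerAtTwoSignedKatoUpToAtTwoKatoBKCoreKZLit
import Summits.BirchSwinnertonDyer.BirchSwinnertonDyer.Theorems.ThetaPartnerAtTwoSignedKatoUpToAtTwoOfPubKBK
import Summits.BirchSwinnertonDyer.BirchSwinnertonDyer.Theorems.ThetaPartnerAtTwoSignedKatoUpToAtTwoKatoBKBricks
import Summits.BirchSwinnertonDyer.BirchSwinnertonDyer.Theorems.ThetaPartnerAtTwoSignedKatoUpToAtTwoCorePairCertificates
import Summits.BirchSwinnertonDyer.BirchSwinnertonDyer.Theses.ResidualThetaTransportAtTwo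
import HarnessLib

/-!
# Route `ThetaPartnerAtTwo` (TP2) / `ResidualThetaTransportAtTwo` (RTT), crux K3 `SignedKatoDivisibilityUpToAtTwo` (stmt-BirchSwinnertonDyer-20308)
# and K3P′ `SignedKatoDivisibilityUpToAtTwoOfPub` (stmt-BirchSwinnertonDyer-25631), line `colemanrat` v14.1 — CERTIFICATES BY NAME over
# CORE_KZ_Lit (the published input IN LITERATURE VOCABULARY): K3P′ ⟸ CORE_KZ_Lit alone; K3 (TP2 and RTT readings) ⟸ {Kato 13.4 (2) at `2`, GZK, CORE_KZ_Lit}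

Lead prover `bsd-wall-tp2-p2x` g8 (cell `bsd-wall`). CORE_KZ_Lit = hypothesis of `KatoBK.coreKZ_of_coreKZLit` (`…KatoBKCoreKZLit.lean`, p640162):
Kato's `2`-adic zeta values at the standard complex embeddings (`ZetaBody`) ∧ the layer Tate pairing law for the displayed classes, written with
Literature + Mathlib names only (`CyclotomicLayer.tatePairingPk`, `Kato2004.levelToLayerTwo`, `WeierstrassCurve.formalLog`, `zCoord`, a coherent
`2`-adic frame `e`). It is the text of the Literature fact `Kato2004.exists_eulerSystem_expStar_tatePairing_values_two` (proposed p640688, review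
lane). Here: `coreKZ_of_coreKZLit`, then w3 g8's socket `corePairChiPrim_of_coreKZ_of_bricks` with the four kernel bricks by name (`cuspBrick_unconditional`,
`heckeBaseTwo_brick`, `logBaseTwo_brick`, `katoTrivialValuesTwo_brick`), then w3 g6's certificates `CoreChi.…_of_corePairChiPrim` — the same chain as
w3 g8's `…OfPubKZ.lean` (p638249), one step further out. HONEST FRAMING: compositions only
(no definition, no named fact, no instance, no `sorry`); every theorem DISPLAYS its hypotheses; closes no item; K3 / K3P′ NOT settled; BSD is NOT
proved by any of this.
-/

set_option autoImplicit false
-- the Theorems namespace of this sub repeats the summit name by design (D-0017 nested layout)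
set_option linter.dupNamespace false

noncomputable section

set_option backward.isDefEq.respectTransparency false

open scoped Classical MatrixGroups ModularForm NumberField TensorProduct

open CongruenceSubgroup WeierstrassCurve Field IsDedekindDomain NumberField
  Literature.NumberTheory.GaloisRepresentations
  Literature.NumberTheory.EllipticCurves Literature.NumberTheory.EllipticCurves.ModularForms
  Literature.NumberTheory.EllipticCurves.Module Literature.NumberTheory.EllipticCurves.Rank1Residual
  Literature.NumberTheory.EllipticCurves.Kobayashi2003 Literature.NumberTheory.EllipticCurves.Kato2004
  Literature.NumberTheory.EllipticCurves.Kato2004.EulerSystemValues Literature.NumberTheory.EllipticCurves.GreenbergSelmer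
  Literature.NumberTheory.EllipticCurves.Sprung2012
  Literature.NumberTheory.EllipticCurves.FormalGroupChart
  ZpExtension Summit.BirchSwinnertonDyer.Rank1Residual.Supersingular

namespace Summit.BirchSwinnertonDyer.BirchSwinnertonDyer.Theorems.SignedKatoOffTwo.KatoBK

/-- **K3P′ BY NAME ⟸ CORE_KZ_Lit ALONE** (TP2 decl `SignedKatoDivisibilityUpToAtTwoOfPub`, item stmt-BirchSwinnertonDyer-25631): the published input
in Literature vocabulary, through `coreKZ_of_coreKZLit`, the CORE_KZ socket with its four kernel bricks by name, and w3 g6's `CoreChi.signedKatoDivisibilityUpToAtTwoOfPub_of_corePairChiPrim`. CONDITIONAL on the displayed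
hypothesis; closes nothing by itself; BSD is not proved by this.
[cite: Kato2004Asterisque, Thm. 12.5 (1) (pp. 221–222), Ex. 13.3 (p. 225)] [cite: Rubin1998Durham, §5 display (2), Thm. 7.1]
[cite: Kobayashi2003, (8.23), (8.29), Prop. 8.25, Thm. 6.3] -/
theorem signedKatoDivisibilityUpToAtTwoOfPub_of_coreKZLit
    (hlit :
      ∀ (v : HeightOneSpectrum (𝓞 ℚ)), ((2 : ℕ) : 𝓞 ℚ) ∈ v.asIdeal →
      ∀ (W : WeierstrassCurve ℚ) [W.IsElliptic] [W.IsGloballyMinimal], GoodSS W 2 →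
        ∀ (κ : ZpExtension ℚ 2) (hκ : κ.IsCyclotomic),
          ∀ [NeZero (W.conductorNorm ℤ)] (f : CuspForm (Gamma0 (W.conductorNorm ℤ)) 2), IsNewformOf W f →
          ∀ [ContinuousSMul ℤ_[2] (W.tateModule 2)] [Module.Free ℤ_[2] (W.tateModule 2)]
            [Module.Finite ℤ_[2] (W.tateModule 2)],
          ∀ (Φ : AlgebraicClosure ℚ_[2] ≃ₐ[ℚ] AlgebraicClosure (v.adicCompletion ℚ)) (φ : ℚ_[2] ≃+* v.adicCompletion ℚ),
            (∀ y : ℚ_[2], Φ (algebraMap ℚ_[2] (AlgebraicClosure ℚ_[2]) y) =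
              algebraMap (v.adicCompletion ℚ) (AlgebraicClosure (v.adicCompletion ℚ)) (φ y)) →
          ∀ (e : ∀ k : ℕ, CyclotomicField (cycLevel 2 k ∅) ℚ →ₐ[ℚ] PadicAlgCl 2)
            (τ : ∀ m : ℕ, ZMod (2 ^ m) → Field.absoluteGaloisGroup ℚ_[2]),
            -- the `2`-adic frame: a COHERENT tower `e_{k+1}(ζ_{2^{k+1}})² = e_k(ζ_{2^k})` with Galois lifts `τ_a : e_k(ζ) ↦ e_k(ζ)^a`
            (∀ k : ℕ, e (k + 1) (IsCyclotomicExtension.zeta (cycLevel 2 (k + 1) ∅) ℚ (CyclotomicField (cycLevel 2 (k + 1) ∅) ℚ)) ^ 2 =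
              e k (IsCyclotomicExtension.zeta (cycLevel 2 k ∅) ℚ (CyclotomicField (cycLevel 2 k ∅) ℚ))) →
            (∀ (k : ℕ) (a : ZMod (2 ^ k)), IsUnit a →
              τ k a • e k (IsCyclotomicExtension.zeta (cycLevel 2 k ∅) ℚ (CyclotomicField (cycLevel 2 k ∅) ℚ)) =
                e k (IsCyclotomicExtension.zeta (cycLevel 2 k ∅) ℚ (CyclotomicField (cycLevel 2 k ∅) ℚ)) ^ a.val) →
          -- the complex frame: the STANDARD embeddings at the pure levels (Kato (5.7.1))
          ∀ (ιC : (m : ℕ) → (CyclotomicField m ℚ →+* ℂ)),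
          (∀ k : ℕ, ιC (cycLevel 2 k ∅) (IsCyclotomicExtension.zeta (cycLevel 2 k ∅) ℚ (CyclotomicField (cycLevel 2 k ∅) ℚ)) =
            Complex.exp (2 * Real.pi * Complex.I / (cycLevel 2 k ∅ : ℕ))) →
          ∃ κK : ℝ, κK ≠ 0 ∧
          ∃ ΛK : ∀ (k : ℕ) (r : Finset (HeightOneSpectrum (𝓞 ℚ))),
              H1 (tateRep W 2) (cycSubgroup 2 k r) →ₗ[ℤ_[2]] ℚ_[2] ⊗[ℚ] CyclotomicField (cycLevel 2 k r) ℚ,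
            ∀ (c d a : ℤ) (A : ℕ), 0 < A → Int.gcd c (6 * 2 * A) = 1 → Int.gcd d (6 * 2 * W.conductorNorm ℤ) = 1 →
              ∃ (z : ∀ (k : ℕ) (r : (cyclotomicLevelsRat 2 (badPlaces c d A (W.conductorNorm ℤ))).Ideals),
                    H1 (tateRep W 2) ((cyclotomicLevelsRat 2 (badPlaces c d A (W.conductorNorm ℤ))).level k r.1))
                (x : ∀ (k : ℕ) (r : (cyclotomicLevelsRat 2 (badPlaces c d A (W.conductorNorm ℤ))).Ideals),
                    CyclotomicField (cycLevel 2 k r.1) ℚ),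
                ZetaBody W 2 f ιC κK ΛK c d a A z x ∧
                ∀ (n : ℕ) (Q₀ : localPoints W ℚ_[2])
                  (hQv : WeierstrassCurve.Affine.Point.map (W' := W)
                      (Φ : AlgebraicClosure ℚ_[2] →ₐ[ℚ] AlgebraicClosure (v.adicCompletion ℚ))
                      (show (W.baseChange (AlgebraicClosure ℚ_[2])).toAffine.Point from Q₀) ∈
                    localLayerPointsOfEmb κ (closureEmb (K := ℚ) (v.adicCompletion ℚ)) W n),
                  (∀ (X Y : AlgebraicClosure ℚ_[2]) (hXY : (W.baseChange (AlgebraicClosure ℚ_[2])).toAffine.Nonsingular X Y),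
                      (show (W.baseChange (AlgebraicClosure ℚ_[2])).toAffine.Point from Q₀) = .some X Y hXY → 1 < Valued.v X) →
                  ∃ t : ℤ_[2],
                    (∀ k : ℕ, CyclotomicLayer.tatePairingPk W κ v n k
                        (levelToLayerTwo W hκ (∅ : Set (HeightOneSpectrum (𝓞 ℚ))) n
                          (z (n + 2) (cyclotomicLevelsRat 2 (badPlaces c d A (W.conductorNorm ℤ))).idealOne))
                        ⟨_, hQv⟩ = PadicInt.toZModPow k t) ∧
                    algebraMap ℚ_[2] (PadicAlgCl 2) (t : ℚ_[2]) =
                      ∑ b : (ZMod (2 ^ (n + 2)))ˣ, τ (n + 2) (b : ZMod (2 ^ (n + 2))) •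
                        ((∑' i : ℕ, algebraMap ℚ_[2] (PadicAlgCl 2) (PowerSeries.coeff i (W.map (algebraMap ℚ ℚ_[2])).formalLog) *
                            (WeierstrassCurve.Affine.Point.zCoord
                              (show (W.baseChange (AlgebraicClosure ℚ_[2])).toAffine.Point from Q₀)) ^ i) *
                          e (n + 2) (x (n + 2) (cyclotomicLevelsRat 2 (badPlaces c d A (W.conductorNorm ℤ))).idealOne))) :
    Summit.BirchSwinnertonDyer.BirchSwinnertonDyer.Theses.ThetaPartnerAtTwo.SignedKatoDivisibilityUpToAtTwoOfPub :=
  CoreChi.signedKatoDivisibilityUpToAtTwoOfPub_of_corePairChiPrim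
    (corePairChiPrim_of_coreKZ_of_bricks (coreKZ_of_coreKZLit hlit) cuspBrick_unconditional heckeBaseTwo_brick logBaseTwo_brick
      katoTrivialValuesTwo_brick)

/-- **K3 BY NAME (TP2 decl `SignedKatoDivisibilityUpToAtTwo`, item stmt-BirchSwinnertonDyer-20308) ⟸ {Kato Thm. 13.4 (2) at `2` (Literature fact,
unproved), GZK (Literature fact, unproved), CORE_KZ_Lit}** — w3 g6's `CoreChi.signedKatoDivisibilityUpToAtTwo_of_contraFact_of_gzk_of_corePairChiPrim` over the CORE_KZ socket
(four kernel bricks by name) and `coreKZ_of_coreKZLit`. CONDITIONAL on the three displayed hypotheses; closes nothing by itself; BSD is not proved by this.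
[cite: Kato2004Asterisque, Thm. 13.4 (2) (p. 226), Thm. 12.5 (1) (pp. 221–222)] [cite: GrossZagier1986, Thm. I.6.3] [cite: Kolyvagin1990, Thm. A]
[cite: Rubin1998Durham, §5 display (2), Thm. 7.1] -/
theorem signedKatoDivisibilityUpToAtTwo_of_contraFact_of_gzk_of_coreKZLit
    (hK2 : Kato2004.thm13_4_two_lengthAt_fineSelmerDualContra_le_of_isEulerSystemClassTwo)
    (hGZK : rank_eq_analyticRank_of_analyticRank_le_one)
    (hlit :
      ∀ (v : HeightOneSpectrum (𝓞 ℚ)), ((2 : ℕ) : 𝓞 ℚ) ∈ v.asIdeal →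
      ∀ (W : WeierstrassCurve ℚ) [W.IsElliptic] [W.IsGloballyMinimal], GoodSS W 2 →
        ∀ (κ : ZpExtension ℚ 2) (hκ : κ.IsCyclotomic),
          ∀ [NeZero (W.conductorNorm ℤ)] (f : CuspForm (Gamma0 (W.conductorNorm ℤ)) 2), IsNewformOf W f →
          ∀ [ContinuousSMul ℤ_[2] (W.tateModule 2)] [Module.Free ℤ_[2] (W.tateModule 2)]
            [Module.Finite ℤ_[2] (W.tateModule 2)],
          ∀ (Φ : AlgebraicClosure ℚ_[2] ≃ₐ[ℚ] AlgebraicClosure (v.adicCompletion ℚ)) (φ : ℚ_[2] ≃+* v.adicCompletion ℚ),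
            (∀ y : ℚ_[2], Φ (algebraMap ℚ_[2] (AlgebraicClosure ℚ_[2]) y) =
              algebraMap (v.adicCompletion ℚ) (AlgebraicClosure (v.adicCompletion ℚ)) (φ y)) →
          ∀ (e : ∀ k : ℕ, CyclotomicField (cycLevel 2 k ∅) ℚ →ₐ[ℚ] PadicAlgCl 2)
            (τ : ∀ m : ℕ, ZMod (2 ^ m) → Field.absoluteGaloisGroup ℚ_[2]),
            -- the `2`-adic frame: a COHERENT tower `e_{k+1}(ζ_{2^{k+1}})² = e_k(ζ_{2^k})` with Galois lifts `τ_a : e_k(ζ) ↦ e_k(ζ)^a`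
            (∀ k : ℕ, e (k + 1) (IsCyclotomicExtension.zeta (cycLevel 2 (k + 1) ∅) ℚ (CyclotomicField (cycLevel 2 (k + 1) ∅) ℚ)) ^ 2 =
              e k (IsCyclotomicExtension.zeta (cycLevel 2 k ∅) ℚ (CyclotomicField (cycLevel 2 k ∅) ℚ))) →
            (∀ (k : ℕ) (a : ZMod (2 ^ k)), IsUnit a →
              τ k a • e k (IsCyclotomicExtension.zeta (cycLevel 2 k ∅) ℚ (CyclotomicField (cycLevel 2 k ∅) ℚ)) =
                e k (IsCyclotomicExtension.zeta (cycLevel 2 k ∅) ℚ (CyclotomicField (cycLevel 2 k ∅) ℚ)) ^ a.val) →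
          -- the complex frame: the STANDARD embeddings at the pure levels (Kato (5.7.1))
          ∀ (ιC : (m : ℕ) → (CyclotomicField m ℚ →+* ℂ)),
          (∀ k : ℕ, ιC (cycLevel 2 k ∅) (IsCyclotomicExtension.zeta (cycLevel 2 k ∅) ℚ (CyclotomicField (cycLevel 2 k ∅) ℚ)) =
            Complex.exp (2 * Real.pi * Complex.I / (cycLevel 2 k ∅ : ℕ))) →
          ∃ κK : ℝ, κK ≠ 0 ∧
          ∃ ΛK : ∀ (k : ℕ) (r : Finset (HeightOneSpectrum (𝓞 ℚ))),
              H1 (tateRep W 2) (cycSubgroup 2 k r) →ₗ[ℤ_[2]] ℚ_[2] ⊗[ℚ] CyclotomicField (cycLevel 2 k r) ℚ,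
            ∀ (c d a : ℤ) (A : ℕ), 0 < A → Int.gcd c (6 * 2 * A) = 1 → Int.gcd d (6 * 2 * W.conductorNorm ℤ) = 1 →
              ∃ (z : ∀ (k : ℕ) (r : (cyclotomicLevelsRat 2 (badPlaces c d A (W.conductorNorm ℤ))).Ideals),
                    H1 (tateRep W 2) ((cyclotomicLevelsRat 2 (badPlaces c d A (W.conductorNorm ℤ))).level k r.1))
                (x : ∀ (k : ℕ) (r : (cyclotomicLevelsRat 2 (badPlaces c d A (W.conductorNorm ℤ))).Ideals),
                    CyclotomicField (cycLevel 2 k r.1) ℚ),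
                ZetaBody W 2 f ιC κK ΛK c d a A z x ∧
                ∀ (n : ℕ) (Q₀ : localPoints W ℚ_[2])
                  (hQv : WeierstrassCurve.Affine.Point.map (W' := W)
                      (Φ : AlgebraicClosure ℚ_[2] →ₐ[ℚ] AlgebraicClosure (v.adicCompletion ℚ))
                      (show (W.baseChange (AlgebraicClosure ℚ_[2])).toAffine.Point from Q₀) ∈
                    localLayerPointsOfEmb κ (closureEmb (K := ℚ) (v.adicCompletion ℚ)) W n),
                  (∀ (X Y : AlgebraicClosure ℚ_[2]) (hXY : (W.baseChange (AlgebraicClosure ℚ_[2])).toAffine.Nonsingular X Y),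
                      (show (W.baseChange (AlgebraicClosure ℚ_[2])).toAffine.Point from Q₀) = .some X Y hXY → 1 < Valued.v X) →
                  ∃ t : ℤ_[2],
                    (∀ k : ℕ, CyclotomicLayer.tatePairingPk W κ v n k
                        (levelToLayerTwo W hκ (∅ : Set (HeightOneSpectrum (𝓞 ℚ))) n
                          (z (n + 2) (cyclotomicLevelsRat 2 (badPlaces c d A (W.conductorNorm ℤ))).idealOne))
                        ⟨_, hQv⟩ = PadicInt.toZModPow k t) ∧
                    algebraMap ℚ_[2] (PadicAlgCl 2) (t : ℚ_[2]) =
                      ∑ b : (ZMod (2 ^ (n + 2)))ˣ, τ (n + 2) (b : ZMod (2 ^ (n + 2))) •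
                        ((∑' i : ℕ, algebraMap ℚ_[2] (PadicAlgCl 2) (PowerSeries.coeff i (W.map (algebraMap ℚ ℚ_[2])).formalLog) *
                            (WeierstrassCurve.Affine.Point.zCoord
                              (show (W.baseChange (AlgebraicClosure ℚ_[2])).toAffine.Point from Q₀)) ^ i) *
                          e (n + 2) (x (n + 2) (cyclotomicLevelsRat 2 (badPlaces c d A (W.conductorNorm ℤ))).idealOne))) :
    Summit.BirchSwinnertonDyer.BirchSwinnertonDyer.Theses.ThetaPartnerAtTwo.SignedKatoDivisibilityUpToAtTwo :=
  CoreChi.signedKatoDivisibilityUpToAtTwo_of_contraFact_of_gzk_of_corePairChiPrim hK2 hGZK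
    (corePairChiPrim_of_coreKZ_of_bricks (coreKZ_of_coreKZLit hlit) cuspBrick_unconditional heckeBaseTwo_brick logBaseTwo_brick
      katoTrivialValuesTwo_brick)

/-- The same certificate read on the second route wanting K3 (`route-BirchSwinnertonDyer-ResidualThetaTransportAtTwo`; byte-identical body).
CONDITIONAL; closes nothing by itself; BSD is not proved by this. [cite: Kato2004Asterisque, Thm. 13.4 (2) (p. 226), Thm. 12.5 (1) (pp. 221–222)] -/
theorem signedKatoDivisibilityUpToAtTwo_rtt_of_contraFact_of_gzk_of_coreKZLit
    (hK2 : Kato2004.thm13_4_two_lengthAt_fineSelmerDualContra_le_of_isEulerSystemClassTwo)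
    (hGZK : rank_eq_analyticRank_of_analyticRank_le_one)
    (hlit :
      ∀ (v : HeightOneSpectrum (𝓞 ℚ)), ((2 : ℕ) : 𝓞 ℚ) ∈ v.asIdeal →
      ∀ (W : WeierstrassCurve ℚ) [W.IsElliptic] [W.IsGloballyMinimal], GoodSS W 2 →
        ∀ (κ : ZpExtension ℚ 2) (hκ : κ.IsCyclotomic),
          ∀ [NeZero (W.conductorNorm ℤ)] (f : CuspForm (Gamma0 (W.conductorNorm ℤ)) 2), IsNewformOf W f →
          ∀ [ContinuousSMul ℤ_[2] (W.tateModule 2)] [Module.Free ℤ_[2] (W.tateModule 2)]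
            [Module.Finite ℤ_[2] (W.tateModule 2)],
          ∀ (Φ : AlgebraicClosure ℚ_[2] ≃ₐ[ℚ] AlgebraicClosure (v.adicCompletion ℚ)) (φ : ℚ_[2] ≃+* v.adicCompletion ℚ),
            (∀ y : ℚ_[2], Φ (algebraMap ℚ_[2] (AlgebraicClosure ℚ_[2]) y) =
              algebraMap (v.adicCompletion ℚ) (AlgebraicClosure (v.adicCompletion ℚ)) (φ y)) →
          ∀ (e : ∀ k : ℕ, CyclotomicField (cycLevel 2 k ∅) ℚ →ₐ[ℚ] PadicAlgCl 2)
            (τ : ∀ m : ℕ, ZMod (2 ^ m) → Field.absoluteGaloisGroup ℚ_[2]),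
            -- the `2`-adic frame: a COHERENT tower `e_{k+1}(ζ_{2^{k+1}})² = e_k(ζ_{2^k})` with Galois lifts `τ_a : e_k(ζ) ↦ e_k(ζ)^a`
            (∀ k : ℕ, e (k + 1) (IsCyclotomicExtension.zeta (cycLevel 2 (k + 1) ∅) ℚ (CyclotomicField (cycLevel 2 (k + 1) ∅) ℚ)) ^ 2 =
              e k (IsCyclotomicExtension.zeta (cycLevel 2 k ∅) ℚ (CyclotomicField (cycLevel 2 k ∅) ℚ))) →
            (∀ (k : ℕ) (a : ZMod (2 ^ k)), IsUnit a →
              τ k a • e k (IsCyclotomicExtension.zeta (cycLevel 2 k ∅) ℚ (CyclotomicField (cycLevel 2 k ∅) ℚ)) =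
                e k (IsCyclotomicExtension.zeta (cycLevel 2 k ∅) ℚ (CyclotomicField (cycLevel 2 k ∅) ℚ)) ^ a.val) →
          -- the complex frame: the STANDARD embeddings at the pure levels (Kato (5.7.1))
          ∀ (ιC : (m : ℕ) → (CyclotomicField m ℚ →+* ℂ)),
          (∀ k : ℕ, ιC (cycLevel 2 k ∅) (IsCyclotomicExtension.zeta (cycLevel 2 k ∅) ℚ (CyclotomicField (cycLevel 2 k ∅) ℚ)) =
            Complex.exp (2 * Real.pi * Complex.I / (cycLevel 2 k ∅ : ℕ))) →
          ∃ κK : ℝ, κK ≠ 0 ∧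
          ∃ ΛK : ∀ (k : ℕ) (r : Finset (HeightOneSpectrum (𝓞 ℚ))),
              H1 (tateRep W 2) (cycSubgroup 2 k r) →ₗ[ℤ_[2]] ℚ_[2] ⊗[ℚ] CyclotomicField (cycLevel 2 k r) ℚ,
            ∀ (c d a : ℤ) (A : ℕ), 0 < A → Int.gcd c (6 * 2 * A) = 1 → Int.gcd d (6 * 2 * W.conductorNorm ℤ) = 1 →
              ∃ (z : ∀ (k : ℕ) (r : (cyclotomicLevelsRat 2 (badPlaces c d A (W.conductorNorm ℤ))).Ideals),
                    H1 (tateRep W 2) ((cyclotomicLevelsRat 2 (badPlaces c d A (W.conductorNorm ℤ))).level k r.1))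
                (x : ∀ (k : ℕ) (r : (cyclotomicLevelsRat 2 (badPlaces c d A (W.conductorNorm ℤ))).Ideals),
                    CyclotomicField (cycLevel 2 k r.1) ℚ),
                ZetaBody W 2 f ιC κK ΛK c d a A z x ∧
                ∀ (n : ℕ) (Q₀ : localPoints W ℚ_[2])
                  (hQv : WeierstrassCurve.Affine.Point.map (W' := W)
                      (Φ : AlgebraicClosure ℚ_[2] →ₐ[ℚ] AlgebraicClosure (v.adicCompletion ℚ))
                      (show (W.baseChange (AlgebraicClosure ℚ_[2])).toAffine.Point from Q₀) ∈
                    localLayerPointsOfEmb κ (closureEmb (K := ℚ) (v.adicCompletion ℚ)) W n),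
                  (∀ (X Y : AlgebraicClosure ℚ_[2]) (hXY : (W.baseChange (AlgebraicClosure ℚ_[2])).toAffine.Nonsingular X Y),
                      (show (W.baseChange (AlgebraicClosure ℚ_[2])).toAffine.Point from Q₀) = .some X Y hXY → 1 < Valued.v X) →
                  ∃ t : ℤ_[2],
                    (∀ k : ℕ, CyclotomicLayer.tatePairingPk W κ v n k
                        (levelToLayerTwo W hκ (∅ : Set (HeightOneSpectrum (𝓞 ℚ))) n
                          (z (n + 2) (cyclotomicLevelsRat 2 (badPlaces c d A (W.conductorNorm ℤ))).idealOne))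
                        ⟨_, hQv⟩ = PadicInt.toZModPow k t) ∧
                    algebraMap ℚ_[2] (PadicAlgCl 2) (t : ℚ_[2]) =
                      ∑ b : (ZMod (2 ^ (n + 2)))ˣ, τ (n + 2) (b : ZMod (2 ^ (n + 2))) •
                        ((∑' i : ℕ, algebraMap ℚ_[2] (PadicAlgCl 2) (PowerSeries.coeff i (W.map (algebraMap ℚ ℚ_[2])).formalLog) *
                            (WeierstrassCurve.Affine.Point.zCoord
                              (show (W.baseChange (AlgebraicClosure ℚ_[2])).toAffine.Point from Q₀)) ^ i) *
                          e (n + 2) (x (n + 2) (cyclotomicLevelsRat 2 (badPlaces c d A (W.conductorNorm ℤ))).idealOne))) :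
    Summit.BirchSwinnertonDyer.BirchSwinnertonDyer.Theses.ResidualThetaTransportAtTwo.SignedKatoDivisibilityUpToAtTwo :=
  signedKatoDivisibilityUpToAtTwo_of_contraFact_of_gzk_of_coreKZLit hK2 hGZK hlit

end Summit.BirchSwinnertonDyer.BirchSwinnertonDyer.Theorems.SignedKatoOffTwo.KatoBK

end
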